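import Summits.BirchSwinnertonDyer.BirchSwinnertonDyer.Theorems.SignedLowerHalvesSprungLowerDivisibilityAtThreeIotaDoorContraOrbitKato
import HarnessLib

/-!
# Crux `SprungLowerDivisibilityAtThree` (item stmt-BirchSwinnertonDyer-19875; twin route `PrintX8VSC`: cruxes K′ 23732 / C′ 23733), line
# `chromatic-common-zeros`: THE ORBIT FORM, part 5 — the cokernel bound F-α♮′ in its cleanest reading
# **`m(𝔭) ≤ x′(𝔭) + k(ι𝔭)`** («the fine Selmer length at a common zero is at least the common-zero multiplicity minus the MIRROR zeta index»),
# hence the Main-Conjecture DEFECT `k − x′` at `𝔭` is at most the ORBIT EXCESS `e = k + k′ − m` (door: `e = 0`)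

Cell `bsd-ssimc` (host), width seat `cruxlead-stmt-BirchSwinnertonDyer-19875-w2` (gen 12) under the 19875 LEAD; `--supports`
stmt-BirchSwinnertonDyer-19875 `--as helper`; theorems only (no `def`, no named fact, no instance); closes NO item. Sequel of
`…IotaDoorContraOrbit` / `…OrbitFine` / `…OrbitTelescope` / `…OrbitKato` (same seat). Notation at a height-one `𝔭 ∌ p` (print keying, joint
contragredient package `I, Cs, Cf` with `Cs.Z = Cf.Z`, natural-keyed `Y′ : FineSelmerDualData κ γ⁻¹`): `k = ℓ_𝔭(I.H ⧸ Cs.Z)`,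
`j = min_• ℓ_𝔭(Λ ⧸ range C•.colMap)`, `m = min(ℓ_𝔭 Λ/(Gs), ℓ_𝔭 Λ/(Gf))`, `x′ = ℓ_𝔭 Y′.X`, `k′ = k(ι𝔭)`, `j′ = j(ι𝔭)`.

* §1 (package level, `ι`-stability of `(L♯, L♭)` displayed; F-α♮′ displayed at `ι𝔭` towards `𝔭` in the shape consumed by
  `katoFineLowerAt_of_iotaDoor_contra`) `min_lengthAt_quotient_span_le_fine_add_zeta_comap_invol_contra`: **`m ≤ x′ + k′`** — `m = k′ + j′`
  (`k + j` is `ι`-symmetric) and `j′ ≤ x′` (F-α♮′; if `ι𝔭` is not a common zero, `j′ = 0`). With Kato's `x′ ≤ k` (`…OrbitKato`) this pins `x′`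
  in the interval `[m − k′, k]`, of length the orbit excess `e = k + k′ − m ≥ 0`; the door is `e = 0`.
* §2 `min_lengthAt_quotient_span_le_fine_add_zeta_comap_invol_sporadic_contra_of_heldPack_of_thm714 (hPT) (h124) (hMatar) (h714)`: the same
  over the K′ binder telescope of item 23732 (minus its common-zero hypothesis) at ANY sporadic `𝔭` of an X8 pair, for any Néron-normalised
  `Gs, Gf` (extra binders),
  from the born ι-door pack and Sprung Thm. 7.14 (F-α♮′ = w2 g10's `cokerBoundIotaOffT_contra_of_poitouTate_of_thm714` at `ι𝔭`).

HONEST FRAMING: a reading of the landed cokernel bound; nothing is discharged; the residue stubs, K′, C′, K1, leaf X8 and BSD are NOT proved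
here; the pack's facts are printed theorems typed statement-only.

References: [Kato2004Asterisque] Thm. 12.4 (p. 221), Conj. 12.10 (p. 224), (17.13.1) (pp. 279–280); [Sprung2012] Def. 6.1 (p. 1495), §7.1
Props. 7.3/7.6, Thm. 7.14 (3) (p. 1504); [Sprung2017] Thm. 4.13, Cor. 4.14; [Matar2020] Thm. 1.1; [Wingberg1989] Cor. 2.5; [Kobayashi2003]
Prop. 7.1, Thm. 7.3; tree: `…CokerBoundByMassOfThm714` (w2 g10), `…IotaDoorContra` (w3 g9), `…IotaDoorContraOrbit` (w2 g12).
-/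

set_option linter.dupNamespace false
set_option autoImplicit false

noncomputable section

open scoped Classical NumberField MatrixGroups ModularForm

open NumberField IsDedekindDomain CongruenceSubgroup WeierstrassCurve Field
  Literature.NumberTheory.EllipticCurves Literature.NumberTheory.EllipticCurves.ModularForms
  Literature.NumberTheory.EllipticCurves.ZpExtension Literature.NumberTheory.EllipticCurves.Sprung2017
  Literature.NumberTheory.EllipticCurves.Sprung2012 Literature.NumberTheory.EllipticCurves.Rank1Residual
  Literature.NumberTheory.EllipticCurves.IwasawaAlgebra Literature.NumberTheory.EllipticCurves.Kato2004
  Literature.NumberTheory.EllipticCurves.Module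
  Summit.BirchSwinnertonDyer.BirchSwinnertonDyer.Theorems

namespace Summit.BirchSwinnertonDyer.BirchSwinnertonDyer.Theorems.ChromaticCommonZeros

/-! ### §1 `m ≤ x′ + k′` (package level) -/

section Package

variable (W : WeierstrassCurve ℚ) [W.IsElliptic] (p : ℕ) [Fact p.Prime]
  [ContinuousSMul ℤ_[p] (W.tateModule p)] [Module.Free ℤ_[p] (W.tateModule p)]
  [Module.Finite ℤ_[p] (W.tateModule p)]
  {N : ℕ} {f : CuspForm (Gamma0 N) 2} {ϖ : ℚ} {κ : ZpExtension ℚ p} {γ : absoluteGaloisGroup ℚ}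
  {E : Type} [Field E] [Algebra ℚ E] {ι : AlgebraicClosure ℚ →ₐ[ℚ] AlgebraicClosure E} {ap : ℤ}
  {g : absoluteGaloisGroup E} {c : ℕ → localPoints W E} {I : IwasawaH1Data W p κ γ}

/-- **F-α♮′ IN ITS CLEANEST READING: `m(𝔭) ≤ x′(𝔭) + k(ι𝔭)`** (print keying). Joint contragredient package (`ι`-stability of `(L♯, L♭)`, both
colours non-zero and Néron-normalised, `ϖ ≠ 0`, `E[p]` irreducible), natural-keyed `Y′`, height-one `𝔭 ∌ p`; DISPLAYED (hFα) F-α♮′ at `ι𝔭` towards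
`𝔭` («every normalised colour vanishes at `ι𝔭` ⟹ `j(ι𝔭) ≤ x′(𝔭)`»). THEN `min(ℓ_𝔭 Λ/(Gs), ℓ_𝔭 Λ/(Gf)) ≤ ℓ_𝔭 Y′.X + ℓ_{ι𝔭}(I.H ⧸ Cs.Z)`: the fine
Selmer length at `𝔭` is at least the common-zero multiplicity minus the zeta index AT THE MIRROR. (`m = k + j = k′ + j′`; `j′ ≤ x′` if `ι𝔭` is a
common zero, else `j′ = 0`.) With Kato's `x′ ≤ k` the Main-Conjecture defect `k − x′` is at most the orbit excess `k + k′ − m`.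
[cite: Kato2004Asterisque, Conj. 12.10 (p. 224), Thm. 12.6 (p. 222), (17.13.1) (p. 280)] [cite: Sprung2012, Def. 6.1, §7.1, Props. 7.3/7.6, Thm. 7.14 (3)]
[cite: Matar2020, Thm. 1.1] [cite: Wingberg1989, Cor. 2.5] [cite: GreenbergLNM1716, §1] -/
theorem min_lengthAt_quotient_span_le_fine_add_zeta_comap_invol_contra
    (Cs : SharpFlatColemanKatoDataContra W p f ϖ κ γ ι ap g c Chroma.sharp I)
    (Cf : SharpFlatColemanKatoDataContra W p f ϖ κ γ ι ap g c Chroma.flat I) (hZ : Cs.Z = Cf.Z)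
    (hirr : W.HasIrreducibleModPGaloisRep p) (hϖ : ϖ ≠ 0) {Lsharp Lflat Gs Gf : IwasawaAlgebra p}
    (hSP : IsSprungPair f p ap Lsharp Lflat) (hs0 : Lsharp ≠ 0) (hf0 : Lflat ≠ 0)
    (hGs : iwasawaToPowerSeries p Gs =
      PowerSeries.C ((ϖ : ℚ) : ℚ_[p]) * iwasawaToPowerSeries p (chromaticL Chroma.sharp Lsharp Lflat))
    (hGf : iwasawaToPowerSeries p Gf =
      PowerSeries.C ((ϖ : ℚ) : ℚ_[p]) * iwasawaToPowerSeries p (chromaticL Chroma.flat Lsharp Lflat))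
    (hJ : ∀ x ∈ Ideal.span ({Lsharp, Lflat} : Set (IwasawaAlgebra p)),
      invol p x ∈ Ideal.span ({Lsharp, Lflat} : Set (IwasawaAlgebra p)))
    (Y : W.FineSelmerDualData κ γ⁻¹) (𝔭 : PrimeSpectrum (IwasawaAlgebra p)) (h𝔭 : 𝔭.asIdeal.height = 1)
    (hp𝔭 : (p : IwasawaAlgebra p) ∉ 𝔭.asIdeal)
    (hFα : (∀ (col' : Chroma) (G' : IwasawaAlgebra p),
        iwasawaToPowerSeries p G' =
          PowerSeries.C ((ϖ : ℚ) : ℚ_[p]) * iwasawaToPowerSeries p (chromaticL col' Lsharp Lflat) →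
        G' ∈ (PrimeSpectrum.comap (invol p).toRingHom 𝔭).asIdeal) →
      min (Module.lengthAt (IwasawaAlgebra p) (IwasawaAlgebra p ⧸ LinearMap.range Cs.colMap)
            (PrimeSpectrum.comap (invol p).toRingHom 𝔭))
          (Module.lengthAt (IwasawaAlgebra p) (IwasawaAlgebra p ⧸ LinearMap.range Cf.colMap)
            (PrimeSpectrum.comap (invol p).toRingHom 𝔭)) ≤
        Module.lengthAt (IwasawaAlgebra p) Y.X 𝔭) :
    min (Module.lengthAt (IwasawaAlgebra p) (IwasawaAlgebra p ⧸ Ideal.span {Gs}) 𝔭)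
        (Module.lengthAt (IwasawaAlgebra p) (IwasawaAlgebra p ⧸ Ideal.span {Gf}) 𝔭) ≤
      Module.lengthAt (IwasawaAlgebra p) Y.X 𝔭 +
        Module.lengthAt (IwasawaAlgebra p) (I.H ⧸ Cs.Z) (PrimeSpectrum.comap (invol p).toRingHom 𝔭) := by
  have hs : chromaticL Chroma.sharp Lsharp Lflat ≠ 0 := by rwa [chromaticL_sharp]
  have hfl : chromaticL Chroma.flat Lsharp Lflat ≠ 0 := by rwa [chromaticL_flat]
  have h𝔮1 : (PrimeSpectrum.comap (invol p).toRingHom 𝔭).asIdeal.height = 1 := by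
    rw [Kato2004.height_comap_invol, h𝔭]
  -- `m(𝔭) = k + j = k′ + j′`
  rw [min_lengthAt_quotient_span_eq_zeta_add_localIndex_contra W p Cs Cf hZ hirr hSP hs hfl hGs hGf 𝔭 h𝔭,
    zeta_add_localIndex_eq_comap_invol_contra_of_invol_mem W p Cs Cf hZ hirr hϖ hSP hs0 hf0 hGs hGf hJ 𝔭 h𝔭 hp𝔭, add_comm]
  -- `j′ ≤ x′` (F-α♮′) or `j′ = 0`
  gcongr
  by_cases hcommon : ∀ (col' : Chroma) (G' : IwasawaAlgebra p),
      iwasawaToPowerSeries p G' =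
        PowerSeries.C ((ϖ : ℚ) : ℚ_[p]) * iwasawaToPowerSeries p (chromaticL col' Lsharp Lflat) →
      G' ∈ (PrimeSpectrum.comap (invol p).toRingHom 𝔭).asIdeal
  · exact hFα hcommon
  · push Not at hcommon
    obtain ⟨col', G', hG', hG'𝔮⟩ := hcommon
    rw [localIndex_eq_zero_of_normalised_not_mem_contra W p Cs Cf hirr hSP hs hfl _ h𝔮1 hG' hG'𝔮]
    exact bot_le

end Package

/-! ### §2 Over the K′ binder telescope (X8, print keying, sporadic common zero) -/

/-- **`m(𝔭) ≤ x′(𝔭) + k(ι𝔭)` OVER THE K′ BINDER TELESCOPE** (the registered skeleton of item 23732, LEAD g7) with two extra binders `Gs, Gf`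
(Néron-normalised generators of the two colours): from the born ι-door pack (PT functional model `hPT`, Kato 12.4 `h124`, Matar 1.1 `hMatar`) and
Sprung Thm. 7.14 `h714`, at EVERY sporadic height-one `𝔭` (`p ∉ 𝔭`, no `ω̃ₙ ∈ 𝔭`; the common-zero hypothesis of K′ is NOT needed — off the
common zeros `m(𝔭) = 0`) of an X8 pair: `min(ℓ_𝔭 Λ/(Gs), ℓ_𝔭 Λ/(Gf)) ≤ ℓ_𝔭 Y′.X + ℓ_{ι𝔭}(I.H ⧸ Cs.Z)`. F-α♮′ at `ι𝔭` is w2 g10's `cokerBoundIotaOffT_contra_of_poitouTate_of_thm714`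
(read back to `𝔭` through `ιι𝔭 = 𝔭`); `ι`-stability, both colours non-zero, `E[3]` irreducible are X8 theorems. CONDITIONAL on the four
displayed named facts. [cite: Kato2004Asterisque, Thm. 12.4 (p. 221), Conj. 12.10 (p. 224), (17.13.1) (pp. 279–280)]
[cite: Sprung2012, Def. 6.1, Thm. 7.14 (3) (p. 1504)] [cite: Matar2020, Thm. 1.1] [cite: Kobayashi2003, Prop. 7.1, Thm. 7.3 (pp. 12–13)] -/
theorem min_lengthAt_quotient_span_le_fine_add_zeta_comap_invol_sporadic_contra_of_heldPack_of_thm714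
    (hPT : thm714seq_sharpFlat_poitouTate_functionalModel) (h124 : Kato2004.thm12_4)
    (hMatar : matar2020_thm11_selmerDualTorsion_pseudoIso_fineSelmerDual) (h714 : thm714_sharpFlatSelmerDual_finite_torsion) :
    ∀ (W : WeierstrassCurve ℚ) [W.IsElliptic] [W.IsGloballyMinimal] (p : ℕ) [Fact p.Prime]
      [ContinuousSMul ℤ_[p] (W.tateModule p)] [Module.Free ℤ_[p] (W.tateModule p)]
      [Module.Finite ℤ_[p] (W.tateModule p)],
      ClassX8 W p → ∀ (κ : ZpExtension ℚ p) (γ : Field.absoluteGaloisGroup ℚ),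
      κ.IsCyclotomic → κ.IsTopGenerator γ → IsCyclotomicVariable p γ →
    ∀ (v : HeightOneSpectrum (𝓞 ℚ)), (p : 𝓞 ℚ) ∈ v.asIdeal →
    ∀ (g : Field.absoluteGaloisGroup (v.adicCompletion ℚ)),
      κ.IsTopGenerator (resGalOfEmb (closureEmb (K := ℚ) (v.adicCompletion ℚ)) g) →
    ∀ (cneg : localPoints W (v.adicCompletion ℚ)) (c : ℕ → localPoints W (v.adicCompletion ℚ)),
      IsHondaSystem κ (closureEmb (K := ℚ) (v.adicCompletion ℚ)) W (W.frobeniusTrace p) g cneg c →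
    ∀ (N : ℕ) (_ : NeZero N) (f : CuspForm (Gamma0 N) 2) (ϖ : ℚ) (Lsharp Lflat : IwasawaAlgebra p),
      IsNewformOf W f → (ϖ : ℝ) * W.realPeriodRat = plusPeriod f →
      IsSprungPair f p (W.frobeniusTrace p) Lsharp Lflat →
    ∀ (I : Kato2004.IwasawaH1Data W p κ γ)
      (Cs : SharpFlatColemanKatoDataContra W p f ϖ κ γ (closureEmb (K := ℚ) (v.adicCompletion ℚ))
        (W.frobeniusTrace p) g c Chroma.sharp I)
      (Cf : SharpFlatColemanKatoDataContra W p f ϖ κ γ (closureEmb (K := ℚ) (v.adicCompletion ℚ))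
        (W.frobeniusTrace p) g c Chroma.flat I),
      Cs.Z = Cf.Z →
    ∀ (Y : W.FineSelmerDualData κ γ⁻¹) (𝔭 : PrimeSpectrum (IwasawaAlgebra p)), 𝔭.asIdeal.height = 1 →
      (p : IwasawaAlgebra p) ∉ 𝔭.asIdeal →
      (¬ ∃ n : ℕ, ((cyclotomicOmega p n).map (Int.castRingHom ℤ_[p]) : PowerSeries ℤ_[p]) ∈ 𝔭.asIdeal) →
    ∀ (Gs Gf : IwasawaAlgebra p),
      iwasawaToPowerSeries p Gs = PowerSeries.C (ϖ : ℚ_[p]) * iwasawaToPowerSeries p (chromaticL Chroma.sharp Lsharp Lflat) →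
      iwasawaToPowerSeries p Gf = PowerSeries.C (ϖ : ℚ_[p]) * iwasawaToPowerSeries p (chromaticL Chroma.flat Lsharp Lflat) →
      min (Module.lengthAt (IwasawaAlgebra p) (IwasawaAlgebra p ⧸ Ideal.span {Gs}) 𝔭)
          (Module.lengthAt (IwasawaAlgebra p) (IwasawaAlgebra p ⧸ Ideal.span {Gf}) 𝔭) ≤
        Module.lengthAt (IwasawaAlgebra p) Y.X 𝔭 +
          Module.lengthAt (IwasawaAlgebra p) (I.H ⧸ Cs.Z) (PrimeSpectrum.comap (invol p).toRingHom 𝔭) := by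
  intro W _ _ p _ _ _ _ hX κ γ hκ hγ hcv v hv g hg cneg c hH N hN f ϖ Lsharp Lflat hf hϖ hSP I Cs Cf hZ Y 𝔭 h𝔭 hp𝔭
    hspor Gs Gf hGs hGf
  haveI : NeZero N := hN
  obtain ⟨hs0, hf0⟩ :=
    ChromaticBothColours.ClassX8.sharp_ne_zero_and_flat_ne_zero W p hX N inferInstance f Lsharp Lflat hf hSP
  -- `T ∉ 𝔭` (sporadic: `ω̃₀ = T`); the mirror prime `ι𝔭`: height one, `p ∉ ι𝔭`, `T ∉ ι𝔭`
  have hT : (PowerSeries.X : IwasawaAlgebra p) ∉ 𝔭.asIdeal := fun hT =>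
    hspor ⟨0, by rwa [coe_map_cyclotomicOmega_zero]⟩
  obtain ⟨h𝔮, hp𝔮⟩ := comap_invol_heightOne_not_mem 𝔭 h𝔭 hp𝔭
  have hT𝔮 := X_not_mem_comap_invol 𝔭 hT
  refine min_lengthAt_quotient_span_le_fine_add_zeta_comap_invol_contra W p Cs Cf hZ (ClassX8.irr' W p hX)
    (hf.periodRatio_ne_zero hϖ) hSP hs0 hf0 hGs hGf (ClassX8.invol_mem_span_pair W p hX f Lsharp Lflat hf hSP) Y 𝔭 h𝔭 hp𝔭 ?_
  intro hcommon𝔮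
  have h := cokerBoundIotaOffT_contra_of_poitouTate_of_thm714 hPT h124 hMatar h714 W p hX κ γ hκ hγ hcv v hv g hg cneg c hH N
    hN f ϖ Lsharp Lflat hf hϖ hSP I Cs Cf hZ Y (PrimeSpectrum.comap (invol p).toRingHom 𝔭) h𝔮 hp𝔮 hT𝔮 hcommon𝔮
  rwa [Kato2004.comap_invol_comap_invol] at h

end Summit.BirchSwinnertonDyer.BirchSwinnertonDyer.Theorems.ChromaticCommonZeros

end
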